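import Literature.MathematicalPhysics.QuantumLattice.AbelianFluxSectorsProofs
import HarnessLib

/-!
# Parity of the free Wilson–Dirac operator and the vacuum-sector index

Topic `Literature/MathematicalPhysics/QuantumLattice`; namespace `Literature.MathematicalPhysics.QuantumLattice`.
Second proofs companion of `AbelianFluxSectors.lean` (fact `IOSFluxSectorIndex`, [IgarashiOkuyamaSuzuki2002]): the
base case `m = 0` of the finite-volume index formula, i.e. the statement that the FREE Hermitian Wilson–Dirac
operator `H = Γ₅ D_W(U ≡ 1, −1, 1)` of the tree (`wilsonDirac`, HJL App. A conventions, `r = 1`) on the periodic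
lattice `(ℤ/L)⁴` has exactly half of its `4NL⁴` eigenvalues negative (index `0` in the vacuum sector,
`V_{[0]} ≡ 1`, `fluxSectorField_zero`).  Everything is proved; the argument is the textbook parity symmetry
(Montvay–Münster 1994 §4.2: the Wilson action is invariant under the lattice reflections, `γ₅` is a pseudoscalar):

* `siteParity x = (x₀, −x₁, −x₂, −x₃)`, its permutation matrix `siteParityMat = Π`, the free shift matrices
  `siteShiftMat μ = S_μ` (`linkHop_one`: the tree's `U`-twisted shift at `U ≡ 1` is `S_μ ⊗ 1_N`), and
  `Π S₀ Π = S₀`, `Π S_k Π = S_kᴴ` (`k ≠ 0`);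
* `γ₀ γ₅ γ₀ = −γ₅`, `γ₀ P^∓_0 γ₀ = P^∓_0`, `γ₀ P^∓_k γ₀ = P^±_k` (`chiralProjMinus/Plus` of `OverlapLocality`);
* the fermion parity operator `diracParityOp = Π ⊗ 1_N ⊗ γ₀` with `P² = 1`, `P Γ₅ P = −Γ₅`
  (`diracParityOp_mul_spinorLift_gammaFive_mul_diracParityOp`), `P W_μ P = W_μ` for the free hopping matrices and hence
  `P D_W(1, m, 1) P = D_W(1, m, 1)` (`diracParityOp_mul_wilsonDirac_one_mul_diracParityOp`, via
  `wilsonDirac_eq_sub_sum_wilsonHop`) and `P H P = −H` (`diracParityOp_mul_hermitianWilson_one_mul_diracParityOp`);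
* consequences: `two_mul_countP_neg_hermitianWilson_one` (`2N₋ = dim` whenever `det H ≠ 0`, by
  `two_mul_countP_neg_eq_card_of_isHermitian`), Neuberger's free bound `‖D_W(1,m,1)v‖² ≥ m²‖v‖²`
  (`wilsonDirac_one_normSq_ge`, from the tree theorem `wilsonDirac_normSq_mulVec_ge_of_plaquette` at `δ = 0`),
  `det_hermitianWilson_one_ne_zero` (`m ≥ −1`, `m ≠ 0`), `countP_neg_hermitianWilson_u1_free` (`N₋ = 2L⁴` for
  the unit-charge fermion at `m = −1`) and `iosFluxSectorIndex_fluxZero` — literally the conclusion of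
  `IOSFluxSectorIndex` at the flux tensor `m = 0`, for every `L ≥ 1` and either sign `s`.

Not here: any non-zero flux sector (that is the content of the Igarashi–Okuyama–Suzuki theorem).

## References

* I. Montvay, G. Münster, *Quantum Fields on a Lattice*, CUP 1994, §4.2 (lattice symmetries of Wilson fermions). [MontvayMunster1994]
* H. Neuberger, Phys. Rev. D 61 (2000) 085015, arXiv:hep-lat/9911004, §"Lower bound". [Neuberger2000Bounds]
* H. Igarashi, K. Okuyama, H. Suzuki, Nucl. Phys. B 644 (2002) 383, arXiv:hep-lat/0206003. [IgarashiOkuyamaSuzuki2002]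
-/

noncomputable section

open Matrix Finset
open scoped Kronecker
open Literature.Probability.LatticeModels (TorusSite)
open Literature.MathematicalPhysics.QuantumFieldTheory

namespace Literature.MathematicalPhysics.QuantumLattice

variable {L N : ℕ} {G : Type*} [Group G] (ρ : G →* Matrix (Fin N) (Fin N) ℂ)

/-! ### Site parity -/

/-- **Site parity** about the origin of the periodic lattice `(ℤ/L)⁴`, keeping the `0`-axis:
`x ↦ (x₀, −x₁, −x₂, −x₃)`. [folklore] -/
def siteParity (x : TorusSite 4 L) : TorusSite 4 L := fun i => if i = 0 then x i else -x i

omit [Group G] in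
/-- Site parity is an involution. [folklore] -/
@[simp] theorem siteParity_siteParity (x : TorusSite 4 L) : siteParity (siteParity x) = x := by
  funext i
  by_cases h : i = 0 <;> simp [siteParity, h]

omit [Group G] in
/-- Parity commutes with the shift along the kept axis: `P(x + 0̂) = P(x) + 0̂`. [folklore] -/
theorem siteParity_shift_zero (x : TorusSite 4 L) :
    siteParity (Site.shift x 0) = Site.shift (siteParity x) 0 := by
  funext i
  by_cases h : i = 0
  · subst h; simp [siteParity, Site.shift]
  · simp [siteParity, Site.shift, h]

omit [Group G] in
/-- Parity reverses the shifts along the flipped axes: `P(x + k̂) = P(x) − k̂` for `k ≠ 0`. [folklore] -/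
theorem siteParity_shift_of_ne_zero (x : TorusSite 4 L) {k : Fin 4} (hk : k ≠ 0) :
    siteParity (Site.shift x k) = siteParity x - Pi.single k 1 := by
  funext i
  by_cases h : i = 0
  · subst h
    simp [siteParity, Site.shift, Pi.single_eq_of_ne (Ne.symm hk)]
  · by_cases hik : i = k
    · subst hik; simp [siteParity, Site.shift, h]; ring
    · simp [siteParity, Site.shift, h, Pi.single_eq_of_ne hik]

/-- The **parity permutation matrix** on sites, `Π(x,y) = δ_{y, P x}`. [folklore] -/
def siteParityMat : Matrix (TorusSite 4 L) (TorusSite 4 L) ℂ :=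
  Matrix.of fun x y => if y = siteParity x then 1 else 0

/-- The **unit forward shift matrix** in direction `μ`, `S_μ(x,y) = δ_{y, x+μ̂}` (the free `linkHop`). [folklore] -/
def siteShiftMat (μ : Fin 4) : Matrix (TorusSite 4 L) (TorusSite 4 L) ℂ :=
  Matrix.of fun x y => if y = Site.shift x μ then 1 else 0

omit [Group G] in
/-- Left multiplication by `Π` permutes rows: `(Π M)(x, y) = M(P x, y)`. [folklore] -/
theorem siteParityMat_mul_apply [NeZero L] (M : Matrix (TorusSite 4 L) (TorusSite 4 L) ℂ)
    (x y : TorusSite 4 L) :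
    (siteParityMat * M : Matrix (TorusSite 4 L) (TorusSite 4 L) ℂ) x y = M (siteParity x) y := by
  simp only [Matrix.mul_apply, siteParityMat, Matrix.of_apply, ite_mul, one_mul, zero_mul,
    Finset.sum_ite_eq', Finset.mem_univ, if_true]

omit [Group G] in
/-- Right multiplication by `Π` permutes columns: `(M Π)(x, y) = M(x, P y)`. [folklore] -/
theorem mul_siteParityMat_apply [NeZero L] (M : Matrix (TorusSite 4 L) (TorusSite 4 L) ℂ)
    (x y : TorusSite 4 L) :
    (M * siteParityMat : Matrix (TorusSite 4 L) (TorusSite 4 L) ℂ) x y = M x (siteParity y) := by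
  simp only [Matrix.mul_apply, siteParityMat, Matrix.of_apply, mul_ite, mul_one, mul_zero]
  have : ∀ w : TorusSite 4 L, (y = siteParity w) = (w = siteParity y) := by
    intro w
    refine propext ⟨fun h => ?_, fun h => ?_⟩
    · rw [h, siteParity_siteParity]
    · rw [h, siteParity_siteParity]
  simp_rw [this, Finset.sum_ite_eq', Finset.mem_univ, if_true]

omit [Group G] in
/-- `Π² = 1`. [folklore] -/
theorem siteParityMat_mul_self [NeZero L] :
    (siteParityMat : Matrix (TorusSite 4 L) _ ℂ) * siteParityMat = 1 := by
  ext x z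
  rw [siteParityMat_mul_apply, siteParityMat, Matrix.of_apply, Matrix.one_apply]
  by_cases h : x = z
  · subst h; simp
  · rw [if_neg, if_neg h]
    intro hz; apply h; rw [hz, siteParity_siteParity]

omit [Group G] in
/-- `Πᴴ = Π` (a real symmetric permutation matrix, parity being an involution). [folklore] -/
theorem conjTranspose_siteParityMat :
    (siteParityMat : Matrix (TorusSite 4 L) _ ℂ)ᴴ = siteParityMat := by
  ext x y
  simp only [conjTranspose_apply, siteParityMat, Matrix.of_apply, star_ite_zero, star_one]
  by_cases h : y = siteParity x
  · rw [if_pos h, if_pos]; rw [h, siteParity_siteParity]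
  · rw [if_neg h, if_neg]; intro h'; apply h; rw [h', siteParity_siteParity]

omit [Group G] in
/-- `Π S₀ Π = S₀`: parity commutes with the shift along the kept axis. [folklore] -/
theorem siteParityMat_mul_siteShiftMat_zero_mul [NeZero L] :
    (siteParityMat : Matrix (TorusSite 4 L) _ ℂ) * siteShiftMat 0 * siteParityMat = siteShiftMat 0 := by
  ext x z
  rw [mul_siteParityMat_apply, siteParityMat_mul_apply]
  simp only [siteShiftMat, Matrix.of_apply]
  have : siteParity (Site.shift (siteParity x) 0) = Site.shift x 0 := by
    rw [siteParity_shift_zero, siteParity_siteParity]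
  by_cases h : z = Site.shift x 0
  · rw [if_pos h, if_pos]; rw [h, ← this, siteParity_siteParity]
  · rw [if_neg h, if_neg]; intro h'; apply h; rw [← this, ← h', siteParity_siteParity]

omit [Group G] in
/-- `Π S_k Π = S_kᴴ` for `k ≠ 0`: parity turns the forward shift along a flipped axis into the
backward one. [folklore] -/
theorem siteParityMat_mul_siteShiftMat_mul_of_ne_zero [NeZero L] {k : Fin 4} (hk : k ≠ 0) :
    (siteParityMat : Matrix (TorusSite 4 L) _ ℂ) * siteShiftMat k * siteParityMat = (siteShiftMat k)ᴴ := by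
  ext x z
  rw [mul_siteParityMat_apply, siteParityMat_mul_apply]
  simp only [siteShiftMat, Matrix.of_apply, conjTranspose_apply, star_ite_zero, star_one]
  have key : siteParity z = Site.shift (siteParity x) k ↔ x = Site.shift z k := by
    constructor
    · intro h
      have h2 := congrArg siteParity h
      rw [siteParity_siteParity, siteParity_shift_of_ne_zero _ hk, siteParity_siteParity] at h2
      rw [h2, Site.shift, sub_add_cancel]
    · intro h
      rw [h, siteParity_shift_of_ne_zero _ hk, Site.shift, sub_add_cancel]
  by_cases h : x = Site.shift z k
  · rw [if_pos h, if_pos (key.mpr h)]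
  · rw [if_neg h, if_neg (fun h' => h (key.mp h'))]

/-- The free `U`-twisted shift is the plain shift: `F_μ(U ≡ 1) = S_μ ⊗ 1_N`. [folklore] -/
theorem linkHop_one (μ : Fin 4) :
    linkHop ρ (1 : GaugeConfig 4 L G) μ = siteShiftMat μ ⊗ₖ (1 : Matrix (Fin N) (Fin N) ℂ) := by
  ext ⟨x, a⟩ ⟨y, b⟩
  simp only [linkHop, siteShiftMat, Matrix.of_apply, Matrix.kroneckerMap_apply, Pi.one_apply, map_one,
    Matrix.one_apply, ite_mul, one_mul, zero_mul]

/-! ### Spin-space conjugations by `γ₀` -/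

omit [Group G] in
/-- `γ₀ γ_k γ₀ = −γ_k` for `k ≠ 0`. [folklore] -/
theorem gammaZero_mul_gamma_mul_gammaZero {k : Fin 4} (hk : k ≠ 0) :
    euclideanGamma 0 * euclideanGamma k * euclideanGamma 0 = -euclideanGamma k := by
  rw [euclideanGamma_mul_of_ne hk.symm, neg_mul, Matrix.mul_assoc, euclideanGamma_mul_self,
    Matrix.mul_one]

omit [Group G] in
/-- `γ₀ γ₅ γ₀ = −γ₅`. [folklore] -/
theorem gammaZero_mul_gammaFive_mul_gammaZero :
    euclideanGamma 0 * gammaFive * euclideanGamma 0 = -gammaFive := by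
  have h00 := euclideanGamma_mul_self 0
  have push : ∀ (k : Fin 4), k ≠ 0 → ∀ X : Matrix (Fin 4) (Fin 4) ℂ,
      euclideanGamma 0 * (euclideanGamma k * X) = -(euclideanGamma k * (euclideanGamma 0 * X)) := by
    intro k hk X
    rw [← Matrix.mul_assoc, euclideanGamma_mul_of_ne hk.symm, neg_mul, Matrix.mul_assoc]
  -- move the left `γ₀` to the right through `γ₁ γ₂ γ₃`, picking up three signs, then `γ₀ γ₀ = 1`
  have h03 : euclideanGamma 0 * euclideanGamma 3 = -(euclideanGamma 3 * euclideanGamma 0) :=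
    euclideanGamma_mul_of_ne (by decide)
  simp only [gammaFive, Matrix.mul_assoc]
  rw [← Matrix.mul_assoc (euclideanGamma 0) (euclideanGamma 0), h00, Matrix.one_mul,
    push 1 (by decide), push 2 (by decide), h03]
  simp only [mul_neg, neg_neg]

omit [Group G] in
/-- `γ₀ P∓₀ γ₀ = P∓₀` and `γ₀ P±₀ γ₀ = P±₀`. [folklore] -/
theorem gammaZero_mul_chiralProj_zero_mul_gammaZero :
    euclideanGamma 0 * chiralProjMinus 0 * euclideanGamma 0 = chiralProjMinus 0 ∧
      euclideanGamma 0 * chiralProjPlus 0 * euclideanGamma 0 = chiralProjPlus 0 := by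
  have h00 := euclideanGamma_mul_self 0
  constructor
  · rw [chiralProjMinus, Matrix.mul_smul, Matrix.smul_mul, mul_sub, sub_mul, Matrix.mul_one, h00,
      Matrix.one_mul]
  · rw [chiralProjPlus, Matrix.mul_smul, Matrix.smul_mul, mul_add, add_mul, Matrix.mul_one, h00,
      Matrix.one_mul]

omit [Group G] in
/-- `γ₀ P∓_k γ₀ = P±_k` and `γ₀ P±_k γ₀ = P∓_k` for `k ≠ 0`. [folklore] -/
theorem gammaZero_mul_chiralProj_mul_gammaZero_of_ne_zero {k : Fin 4} (hk : k ≠ 0) :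
    euclideanGamma 0 * chiralProjMinus k * euclideanGamma 0 = chiralProjPlus k ∧
      euclideanGamma 0 * chiralProjPlus k * euclideanGamma 0 = chiralProjMinus k := by
  have h00 := euclideanGamma_mul_self 0
  have hk' := gammaZero_mul_gamma_mul_gammaZero hk
  constructor
  · rw [chiralProjMinus, chiralProjPlus, Matrix.mul_smul, Matrix.smul_mul, mul_sub, sub_mul,
      Matrix.mul_one, h00, hk', sub_neg_eq_add]
  · rw [chiralProjMinus, chiralProjPlus, Matrix.mul_smul, Matrix.smul_mul, mul_add, add_mul,
      Matrix.mul_one, h00, hk', ← sub_eq_add_neg]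

omit [Group G] in
/-- `A ⊗ (−B) = −(A ⊗ B)`. [folklore] -/
theorem kronecker_neg' {l m n p : Type*} (A : Matrix l m ℂ) (B : Matrix n p ℂ) :
    A ⊗ₖ (-B) = -(A ⊗ₖ B) := by
  ext ⟨i, j⟩ ⟨i', j'⟩
  simp [Matrix.kroneckerMap_apply]

/-! ### The fermion parity operator -/

/-- **The fermion parity operator** `P = Π ⊗ 1_N ⊗ γ₀` on site × colour × spin:
`(Pψ)(x) = γ₀ ψ(x₀, −x⃗)`. [folklore] -/
def diracParityOp : Matrix (TorusSite 4 L × Fin N × Fin 4) (TorusSite 4 L × Fin N × Fin 4) ℂ :=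
  siteParityMat ⊗ₖ ((1 : Matrix (Fin N) (Fin N) ℂ) ⊗ₖ euclideanGamma 0)

omit [Group G] in
/-- `P² = 1`. [folklore] -/
theorem diracParityOp_mul_self [NeZero L] :
    (diracParityOp : Matrix (TorusSite 4 L × Fin N × Fin 4) _ ℂ) * diracParityOp = 1 := by
  rw [diracParityOp, ← Matrix.mul_kronecker_mul, ← Matrix.mul_kronecker_mul, siteParityMat_mul_self,
    Matrix.mul_one, euclideanGamma_mul_self, Matrix.one_kronecker_one, Matrix.one_kronecker_one]

omit [Group G] in
/-- **`P Γ₅ P = −Γ₅`**: chirality is parity-odd. [folklore] -/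
theorem diracParityOp_mul_spinorLift_gammaFive_mul_diracParityOp [NeZero L] :
    (diracParityOp : Matrix (TorusSite 4 L × Fin N × Fin 4) _ ℂ) * spinorLift gammaFive * diracParityOp =
      -spinorLift gammaFive := by
  rw [diracParityOp, spinorLift, ← Matrix.mul_kronecker_mul, ← Matrix.mul_kronecker_mul,
    ← Matrix.mul_kronecker_mul, ← Matrix.mul_kronecker_mul]
  simp only [Matrix.mul_one, siteParityMat_mul_self, gammaZero_mul_gammaFive_mul_gammaZero,
    kronecker_neg']

/-- **`P W_μ P = W_μ`** for the FREE hopping matrices: for `μ = 0` both Kronecker factors are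
invariant; for `k ≠ 0` parity swaps forward/backward shift AND `P⁻_k`/`P⁺_k`. [folklore] -/
theorem diracParityOp_mul_wilsonHop_one_mul_diracParityOp [NeZero L] (μ : Fin 4) :
    diracParityOp * wilsonHop ρ (1 : GaugeConfig 4 L G) μ * diracParityOp = wilsonHop ρ 1 μ := by
  have hP : (diracParityOp : Matrix (TorusSite 4 L × Fin N × Fin 4) _ ℂ) =
      Matrix.reindex (Equiv.prodAssoc _ _ _) (Equiv.prodAssoc _ _ _)
        ((siteParityMat ⊗ₖ (1 : Matrix (Fin N) (Fin N) ℂ)) ⊗ₖ euclideanGamma 0) := by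
    rw [diracParityOp, Matrix.kronecker_assoc]
  rw [hP, wilsonHop, linkHop_one]
  simp only [Matrix.reindex_apply, Matrix.submatrix_mul_equiv]
  congr 1
  rw [Matrix.conjTranspose_kronecker, conjTranspose_one, mul_add, add_mul, ← Matrix.mul_kronecker_mul,
    ← Matrix.mul_kronecker_mul, ← Matrix.mul_kronecker_mul, ← Matrix.mul_kronecker_mul,
    ← Matrix.mul_kronecker_mul, ← Matrix.mul_kronecker_mul, ← Matrix.mul_kronecker_mul,
    ← Matrix.mul_kronecker_mul, Matrix.mul_one, Matrix.mul_one]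
  by_cases hμ : μ = 0
  · subst hμ
    have h1 := siteParityMat_mul_siteShiftMat_zero_mul (L := L)
    have h2 : (siteParityMat : Matrix (TorusSite 4 L) _ ℂ) * (siteShiftMat 0)ᴴ * siteParityMat =
        (siteShiftMat 0)ᴴ := by
      conv_rhs => rw [← h1]
      rw [conjTranspose_mul, conjTranspose_mul, conjTranspose_siteParityMat, Matrix.mul_assoc]
    rw [h1, h2, gammaZero_mul_chiralProj_zero_mul_gammaZero.1,
      gammaZero_mul_chiralProj_zero_mul_gammaZero.2]
  · have h1 := siteParityMat_mul_siteShiftMat_mul_of_ne_zero (L := L) hμ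
    have h2 : (siteParityMat : Matrix (TorusSite 4 L) _ ℂ) * (siteShiftMat μ)ᴴ * siteParityMat =
        siteShiftMat μ := by
      conv_rhs => rw [← conjTranspose_conjTranspose (siteShiftMat μ), ← h1]
      rw [conjTranspose_mul, conjTranspose_mul, conjTranspose_siteParityMat, Matrix.mul_assoc]
    rw [h1, h2, (gammaZero_mul_chiralProj_mul_gammaZero_of_ne_zero hμ).1,
      (gammaZero_mul_chiralProj_mul_gammaZero_of_ne_zero hμ).2, add_comm]

/-- **The free Wilson–Dirac operator is parity-even**: `P D_W(U ≡ 1, m, 1) P = D_W(U ≡ 1, m, 1)`. [folklore] -/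
theorem diracParityOp_mul_wilsonDirac_one_mul_diracParityOp [NeZero L]
    (hρ : ∀ g, ρ g ∈ Matrix.unitaryGroup (Fin N) ℂ) (m : ℝ) :
    diracParityOp * wilsonDirac ρ (1 : GaugeConfig 4 L G) m 1 * diracParityOp = wilsonDirac ρ 1 m 1 := by
  rw [wilsonDirac_eq_sub_sum_wilsonHop ρ hρ 1 m, Matrix.mul_sub, Matrix.sub_mul, Matrix.mul_smul,
    Matrix.mul_one, Matrix.smul_mul, diracParityOp_mul_self, Finset.mul_sum, Finset.sum_mul]
  congr 1
  exact Finset.sum_congr rfl fun μ _ => diracParityOp_mul_wilsonHop_one_mul_diracParityOp ρ μ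

/-- **The free Hermitian Wilson–Dirac operator is parity-odd**:
`P (Γ₅ D_W(1, m, 1)) P = −Γ₅ D_W(1, m, 1)`. [folklore] -/
theorem diracParityOp_mul_hermitianWilson_one_mul_diracParityOp [NeZero L]
    (hρ : ∀ g, ρ g ∈ Matrix.unitaryGroup (Fin N) ℂ) (m : ℝ) :
    diracParityOp * (spinorLift gammaFive * wilsonDirac ρ (1 : GaugeConfig 4 L G) m 1) * diracParityOp =
      -(spinorLift gammaFive * wilsonDirac ρ (1 : GaugeConfig 4 L G) m 1) := by
  have hPP := diracParityOp_mul_self (L := L) (N := N)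
  calc diracParityOp * (spinorLift gammaFive * wilsonDirac ρ (1 : GaugeConfig 4 L G) m 1) * diracParityOp
      = diracParityOp * spinorLift gammaFive * (diracParityOp * diracParityOp) * wilsonDirac ρ 1 m 1 * diracParityOp := by
        rw [hPP, Matrix.mul_one]; simp only [Matrix.mul_assoc]
    _ = (diracParityOp * spinorLift gammaFive * diracParityOp) * (diracParityOp * wilsonDirac ρ 1 m 1 * diracParityOp) := by
        simp only [Matrix.mul_assoc]
    _ = -(spinorLift gammaFive * wilsonDirac ρ 1 m 1) := by
        rw [diracParityOp_mul_spinorLift_gammaFive_mul_diracParityOp,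
          diracParityOp_mul_wilsonDirac_one_mul_diracParityOp ρ hρ, neg_mul]


/-! ### Symmetric spectrum of the free Hermitian Wilson–Dirac operator -/

/-- The parity operator as a unit (`P⁻¹ = P`). [folklore] -/
def diracParityUnit [NeZero L] : (Matrix (TorusSite 4 L × Fin N × Fin 4) (TorusSite 4 L × Fin N × Fin 4) ℂ)ˣ :=
  ⟨diracParityOp, diracParityOp, diracParityOp_mul_self, diracParityOp_mul_self⟩

/-- **The free Hermitian Wilson–Dirac operator has as many negative as positive eigenvalues**:
if `Γ₅ D_W(U ≡ 1, m, 1)` is invertible then `2 N₋ = dim = 4 N L⁴` (parity conjugates it to its negative).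
[folklore] -/
theorem two_mul_countP_neg_hermitianWilson_one [NeZero L]
    (hρ : ∀ g, ρ g ∈ Matrix.unitaryGroup (Fin N) ℂ) (m : ℝ)
    (hdet : (spinorLift gammaFive * wilsonDirac ρ (1 : GaugeConfig 4 L G) m 1).det ≠ 0) :
    2 * (spinorLift gammaFive * wilsonDirac ρ (1 : GaugeConfig 4 L G) m 1).charpoly.roots.countP
        (fun z : ℂ => z.re < 0) = Fintype.card (TorusSite 4 L × Fin N × Fin 4) := by
  have hH : (spinorLift gammaFive * wilsonDirac ρ (1 : GaugeConfig 4 L G) m 1).IsHermitian := by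
    have h := overlapKernel_isHermitian ρ hρ (1 : GaugeConfig 4 L G) (-m)
    rwa [overlapKernel, neg_neg] at h
  refine two_mul_countP_neg_eq_card_of_isHermitian hH hdet diracParityUnit ?_
  have hinv : (diracParityOp : Matrix (TorusSite 4 L × Fin N × Fin 4) _ ℂ)⁻¹ = diracParityOp :=
    Matrix.inv_eq_left_inv diracParityOp_mul_self
  show diracParityOp * _ * diracParityOp⁻¹ = _
  rw [hinv]
  exact diracParityOp_mul_hermitianWilson_one_mul_diracParityOp ρ hρ m

/-- A quadratic-form lower bound `c Σ‖v‖² ≤ Σ‖Mv‖²` with `c > 0` makes `M` — and `Γ₅ M` — invertible. [folklore] -/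
theorem det_spinorLift_gammaFive_mul_ne_zero_of_normSq_le [NeZero L]
    (M : Matrix (TorusSite 4 L × Fin N × Fin 4) (TorusSite 4 L × Fin N × Fin 4) ℂ) {c : ℝ} (hc : 0 < c)
    (h : ∀ v : TorusSite 4 L × Fin N × Fin 4 → ℂ, c * ∑ i, ‖v i‖ ^ 2 ≤ ∑ i, ‖(M *ᵥ v) i‖ ^ 2) :
    (spinorLift gammaFive * M).det ≠ 0 := by
  rw [Matrix.det_mul]
  refine mul_ne_zero ?_ ?_
  · intro h0
    have h1 := congrArg Matrix.det (spinorLift_gammaFive_mul_self (L := L) (N := N))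
    rw [Matrix.det_mul, h0, zero_mul, Matrix.det_one] at h1
    exact zero_ne_one h1
  · intro h0
    obtain ⟨v, hv0, hv⟩ := Matrix.exists_mulVec_eq_zero_iff.mpr h0
    have h := h v
    rw [hv] at h
    simp only [Pi.zero_apply, norm_zero, ne_eq, OfNat.ofNat_ne_zero, not_false_eq_true, zero_pow,
      Finset.sum_const_zero] at h
    have hpos : 0 < ∑ i, ‖v i‖ ^ 2 := by
      obtain ⟨i, hi⟩ := Function.ne_iff.mp hv0
      exact Finset.sum_pos' (fun _ _ => by positivity) ⟨i, Finset.mem_univ _, by positivity⟩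
    nlinarith

open scoped Matrix.Norms.L2Operator in
/-- **Neuberger's bound in the free field**: `‖D_W(U ≡ 1, m, 1) v‖² ≥ m² ‖v‖²` for `m ≥ −1` (all
plaquettes are `1`, `δ = 0`). [cite: Neuberger2000Bounds, §Lower bound] -/
theorem wilsonDirac_one_normSq_ge [NeZero L] (hρ : ∀ g, ρ g ∈ Matrix.unitaryGroup (Fin N) ℂ)
    (m : ℝ) (hm : -1 ≤ m) (v : TorusSite 4 L × Fin N × Fin 4 → ℂ) :
    m ^ 2 * ∑ i, ‖v i‖ ^ 2 ≤ ∑ i, ‖(wilsonDirac ρ (1 : GaugeConfig 4 L G) m 1 *ᵥ v) i‖ ^ 2 := by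
  have h := wilsonDirac_normSq_mulVec_ge_of_plaquette ρ hρ (1 : GaugeConfig 4 L G) m hm 0 le_rfl
    (fun y μ ν _ => by simp [plaquetteHolonomy]) v
  simpa using h

/-- **The free Hermitian Wilson–Dirac operator `Γ₅ D_W(U ≡ 1, m, 1)` is invertible** for `m ≥ −1`,
`m ≠ 0` (in particular at the overlap point `m = −1`). [cite: Neuberger2000Bounds, §Lower bound] -/
theorem det_hermitianWilson_one_ne_zero [NeZero L] (hρ : ∀ g, ρ g ∈ Matrix.unitaryGroup (Fin N) ℂ)
    (m : ℝ) (hm : -1 ≤ m) (hm0 : m ≠ 0) :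
    (spinorLift gammaFive * wilsonDirac ρ (1 : GaugeConfig 4 L G) m 1).det ≠ 0 :=
  det_spinorLift_gammaFive_mul_ne_zero_of_normSq_le _ (by positivity : 0 < m ^ 2)
    (wilsonDirac_one_normSq_ge ρ hρ m hm)

/-- **The free unit-charge Hermitian Wilson–Dirac operator at the overlap point has exactly `2L⁴`
negative eigenvalues** (half of `dim = 4L⁴`), counted with multiplicity as roots of the characteristic
polynomial. [folklore] -/
theorem countP_neg_hermitianWilson_u1_free (L : ℕ) [NeZero L] :
    (spinorLift gammaFive * wilsonDirac u1Rep (1 : GaugeConfig 4 L Circle) (-1) 1).charpoly.roots.countP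
        (fun z : ℂ => z.re < 0) = 2 * L ^ 4 := by
  have h := two_mul_countP_neg_hermitianWilson_one (L := L) u1Rep u1Rep_mem_unitaryGroup (-1)
    (det_hermitianWilson_one_ne_zero u1Rep u1Rep_mem_unitaryGroup (-1) le_rfl (by norm_num))
  simp only [Fintype.card_prod, Fintype.card_pi, ZMod.card, Finset.prod_const, Finset.card_univ,
    Fintype.card_fin] at h
  omega

/-- **The vacuum-sector instance of `IOSFluxSectorIndex`**: for the flux tensor `m = 0` (`V_{[0]} ≡ 1`)
the Hermitian Wilson–Dirac operator has `2L⁴ = ½ dim` negative eigenvalues, i.e. index `0`, for every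
`L ≥ 1` and either sign `s`. [folklore] -/
theorem iosFluxSectorIndex_fluxZero (L : ℕ) [NeZero L] (s : ℤ) :
    (((spinorLift gammaFive * wilsonDirac u1Rep (fluxSectorField L 0) (-1) 1).charpoly.roots.countP
          fun z : ℂ => z.re < 0 : ℕ) : ℤ) =
      2 * (L : ℤ) ^ 4 + s * ((0 : Fin 4 → Fin 4 → ℤ) 0 1 * (0 : Fin 4 → Fin 4 → ℤ) 2 3 -
        (0 : Fin 4 → Fin 4 → ℤ) 0 2 * (0 : Fin 4 → Fin 4 → ℤ) 1 3 +
        (0 : Fin 4 → Fin 4 → ℤ) 0 3 * (0 : Fin 4 → Fin 4 → ℤ) 1 2) := by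
  rw [fluxSectorField_zero, countP_neg_hermitianWilson_u1_free]
  push_cast
  simp

end Literature.MathematicalPhysics.QuantumLattice

end
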